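import Summits.QuantumFields.YangMills.Theses.HyperbolicRegulator
import Summits.QuantumFields.YangMills.Theorems.HyperbolicToTorus.Negative.ChartRigidity
import Summits.QuantumFields.YangMills.Theorems.PoincareToGap.Negative.Tightness
import Summits.QuantumFields.YangMills.Theorems.PoincareToGap.Negative.PlaquetteVariance

/-!
# Disproof of `HyperbolicToTorus` (stmt-QuantumFields-15827) — standing adversary work file (cdisprove, gen 1, cycle 1)

Crux item `stmt-QuantumFields-15827` = `Summit.QuantumFields.YangMills.Theses.HyperbolicRegulator.HyperbolicToTorus`
(route `HyperbolicRegulator`, rank 4, "hyperbolic family ⇒ symmetric torus"). Prose lives only in docstrings;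
every `theorem` below is checked (rc 0); there is NO `sorry` in this file.

The crux reads (`crux_iff`, DEFINITIONAL — `Iff.rfl` against the route decl): for every compact simple `G`
(Borel σ-algebra) and faithful unitary `r`, for every family `(V E Q σ τ bd cV cE)` indexed by `(k, j)`,
`AdmAll fam → ClustHyp G r fam → TorusGap G r`, where `Adm k j …` (§0) is VERBATIM the first component of
the route's inlined `let Fam := …` vocabulary (conjuncts A1–A9), `FamClust` the second, `ClustHyp` the
uniform-rate clustering hypothesis (verbatim the conclusion of `CurvatureUniformity`) and `TorusGap G r` is
VERBATIM the body of the target `UniformLatticeGap` (stmt-QuantumFields-8778) at `(G, r)`.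

## VERDICT (cycle 1): NO KILL — the crux is irrefutable today, but it is MIS-AIMED twice (findings F1, F3)

* **F0 decoupling (§1).** The conclusion `TorusGap G r` does not mention the family. Hence
  `UniformLatticeGap → HyperbolicToTorus` (`hyperbolicToTorus_of_uniformLatticeGap`) and
  `¬ HyperbolicToTorus → ¬ UniformLatticeGap`; the disproof burden (`not_crux_iff`) is ONE compact simple `G`,
  a faithful `r`, an admissible family clustering at a `k`-uniform rate at all large `β` (i.e. a PROOF of
  `CurvatureAnchor ∧ CurvatureUniformity` for it) AND `¬ TorusGap G r` — the negation of the weak-coupling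
  lattice mass gap (Chatterjee Problem 5.1), unbelieved and out of reach. No junk escapes: `G` is a compact
  simple LIE group (connected, non-abelian, linear), `r` is faithful, `TorusGap`'s `n ≤ S` is tight but only
  as a `(G, r)`-statement (§5).
* **F2 load-bearing analysis (§2).** For the same reason NO `_false_without_H` lemma exists for ANY hypothesis:
  `CruxWithoutAdm`, `CruxWithoutClust` and even `TorusGapAll` (both dropped) are implied by `UniformLatticeGap`
  (`…_of_torusGapAll`, `torusGapAll_iff_uniformLatticeGap`); `cruxWithoutClust_iff` : dropping clustering
  leaves exactly "admissible families exist → lattice gap".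
* **F1 VACUITY THREAT (§3, the main finding; Lean core landed as `Theorems/HyperbolicToTorus/Negative/
  ChartRigidity{Core,}.lean`).** A2–A4 + A9 force every vertex charted at an INTERIOR box position
  (`ℓ^∞ ≤ k/4 - 1`) to have degree 4, but `F` only keeps cones at GRAPH distance `> k/4` while the `ℓ^∞` box
  of radius `k/4` reaches graph distance `2 (k/4)`. In the route's INTENDED witness (k-subdivided `{4,5}`
  complexes) the vertex at offset `(2, k/4 - 1)` from a cone is flat (distance `k/4 + 1`) and its forced flat
  development charts the cone at the interior position `(-2, -(k/4-1))`: contradiction for every `k ≥ 12`.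
  So `CurvatureAnchor`'s intended family is NOT admissible as typed; if NO admissible family exists the present
  crux (and `CurvatureUniformity`) is vacuously TRUE (`crux_of_no_admissible`) and the route is dead at its
  anchor. REPAIR R1 (planner, `--restate` of the shared vocabulary): `F := fun x => x ∈ V ∧ ∀ c ∈ K,
  k / 2 < Γ.dist x c` (then `F = Dp`; the radius-`k/4` box stays within graph distance `k/2`), or charts of
  radius `k/8` with supports `k/16`. Whether an EXOTIC admissible family exists (cores around cones engineered
  so that every flat vertex sees every cone only across a side midpoint of its box) is open; ~1 h of case
  analysis neither produced one nor a contradiction — it is the planner's call, not worth prover time.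
* **F3 NO INFORMATION BELOW THE CURVATURE SCALE (§4).** In `ClustHyp` the constant is `∃ C` AFTER `∀ k`
  (`C = C(β,k,A,B)`). Since chart-read observables are bounded, `FamClust … β m C A B` at scale `k` FOLLOWS from
  clustering restricted to separations `≥ k` plus the trivial bound, with `C' = max C (B₀ e^{m k})`
  (`famClust_of_far`, `clustHypFar_imp`): the hypothesis says NOTHING about correlations inside a flat chart
  (diameter `k/2 < k`). The intended proof ("local limits `k → ∞` are flat Gibbs states clustering at rate `m`
  with the inherited constants") therefore has nothing to inherit: as typed, the prover of this crux must
  produce the torus gap from infrared (trans-curvature) clustering alone. REPAIR R2: move `∃ C` before `∀ k`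
  in BOTH `CurvatureUniformity`'s conclusion and this hypothesis
  (`… ∃ m, 0 < m ∧ ∀ A B, ∃ C, ∀ k, 8 ≤ k → Sp A (k/8) → Sp B (k/8) → ∃ j₀, ∀ j, j₀ ≤ j → (Φ k j).2 β m C A B`).
* **§5** `TorusGap` with `n ≤ S` dropped is false for every `(G, r, β)` (tree: `PoincareToGap.Negative`), but by
  F0 this tightness does not turn into a refutation of a strengthened crux (no hypothesis witness).
* **§6 open / not attempted as theorems.** (i) general (un)satisfiability of `AdmAll` (exotic cores); (ii) the
  planner's own failure mode "hyperbolic-limit Gibbs states ≠ torus states at weak coupling" bears on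
  PROVABILITY only — by F0 it can never yield `¬ HyperbolicToTorus` without `¬ UniformLatticeGap`.

MESSAGE FOR PROVERS / PLANNER. Do not spend prover time before R1/R2: as typed the crux is either vacuous (F1)
or exactly as hard as the target with an uninformative hypothesis (F0 + F3). After R1+R2 the honest content is
"k-uniform clustering of chart-read observables inside flat charts of radius k/4 → ∞ ⇒ some infinite-volume
flat Wilson Gibbs state clusters ⇒ torus gap with S-uniform constants"; the last arrow still needs a
Gibbs-state-to-torus identification at weak coupling (uniqueness is open) and vacuum dominance for `n ≤ S`.
-/

namespace Summit.QuantumFields.YangMills.Cruxes.HyperbolicToTorus.Disproof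

open scoped BigOperators Topology Manifold Classical MeasureTheory ProbabilityTheory Matrix InnerProductSpace ComplexConjugate ContinuousMap
open Filter Set Function TopologicalSpace MeasureTheory
open Summit.QuantumFields.YangMills.Theses.HyperbolicRegulator

/-! ## §0 The crux restated through named predicates (definitionally) -/

/-- **Admissibility** of the member `(k, j)` of a hyperbolic family — VERBATIM the first component
`(Fam k j V E Q σ τ bd cV cE).1` of the route's inlined vocabulary: A1 edges have two distinct endpoints in
`V`; A2 squares: boundary edges in `E`, closed oriented boundary, four distinct corners; A3 every edge in
exactly two squares; A4 degrees `dg ∈ {4,5}` and #squares cornered = `dg`; A5 cones `k`-dense; A6 cones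
pairwise `≥ k` apart; A7 Poincaré inequality with constant `10⁶ k²`; A8 two deep points at distance `≥ j`;
A9 charts of the `ℓ^∞` box of radius `k/4` at every flat point. (`G`-independent.) -/
def Adm (k j : ℕ) (V E Q : Finset ℕ) (σ τ : ℕ → ℕ) (bd : ℕ → Fin 4 → ℕ × Bool) (cV : ℕ → ℤ × ℤ → ℕ) (cE : ℕ → ℤ × ℤ → Fin 2 → ℕ × Bool) : Prop :=
  let st := fun e : ℕ × Bool => if e.2 then σ e.1 else τ e.1; let en := fun e : ℕ × Bool => if e.2 then τ e.1 else σ e.1; let Γ := SimpleGraph.fromRel fun a b : ℕ => ∃ e ∈ E, σ e = a ∧ τ e = b; let dg := fun x : ℕ => (E.filter fun e => σ e = x ∨ τ e = x).card; let K := V.filter fun x => dg x = 5; let F := fun x : ℕ => x ∈ V ∧ ∀ c ∈ K, k / 4 < Γ.dist x c; let Dp := fun x : ℕ => x ∈ V ∧ ∀ c ∈ K, k / 2 < Γ.dist x c; let ib := fun a : ℤ × ℤ => |a.1| ≤ (k : ℤ) / 4 ∧ |a.2| ≤ (k : ℤ) / 4; let nx := fun (a : ℤ × ℤ) (μ : Fin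 2) => if μ = 0 then (a.1 + 1, a.2) else (a.1, a.2 + 1); (∀ e ∈ E, σ e ∈ V ∧ τ e ∈ V ∧ σ e ≠ τ e) ∧ (∀ q ∈ Q, (∀ i, (bd q i).1 ∈ E) ∧ (∀ i, en (bd q i) = st (bd q (i + 1))) ∧ (st ∘ bd q).Injective) ∧ (∀ e ∈ E, (Q.filter fun q => ∃ i, (bd q i).1 = e).card = 2) ∧ (∀ x ∈ V, (dg x = 4 ∨ dg x = 5) ∧ (Q.filter fun q => ∃ i, st (bd q i) = x).card = dg x) ∧ (∀ x ∈ V, ∃ c ∈ K, Γ.dist x c ≤ k) ∧ (∀ c ∈ K, ∀ c' ∈ K, c ≠ c' → k ≤ Γ.dist c c') ∧ (∀ f : ℕ → ℝ, ∑ x ∈ V, f x = 0 → ∑ x ∈ V, f x ^ 2 ≤ 10 ^ 6 * (k : ℝ) ^ 2 * ∑ e ∈ E, (f (σ e) - f (τ e)) ^ 2) ∧ (∃ x y, Dp x ∧ Dp y ∧ j ≤ Γ.dist x y) ∧ (∀ x, F x → cV x (0, 0) = x ∧ (∀ a, ib a → cV x a ∈ V) ∧ Set.InjOn (cV x) {a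 | ib a} ∧ (∀ a μ, ib a → ib (nx a μ) → (cE x a μ).1 ∈ E ∧ st (cE x a μ) = cV x a ∧ en (cE x a μ) = cV x (nx a μ)) ∧ (∀ a, ib a → ib (a.1 + 1, a.2 + 1) → ∃ q ∈ Q, Finset.univ.image (Prod.fst ∘ bd q) = {(cE x a 0).1, (cE x (nx a 0) 1).1, (cE x (nx a 1) 0).1, (cE x a 1).1}))

set_option linter.unusedVariables false in
/-- **Clustering predicate** of the member `(k, j)` — VERBATIM the second component `(Fam k j …).2`:
`FamClust … β m C A B` = all chart-read copies of `A`, `B` at flat base points of `S × S` have connected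
Wilson expectation `≤ C e^{-m (dist x y + dist x' y')}`. -/
def FamClust (G : Type) [Group G] [TopologicalSpace G] [IsTopologicalGroup G] [CompactSpace G]
    [MeasurableSpace G] [BorelSpace G] (r : Literature.MathematicalPhysics.QuantumFieldTheory.LatticeRep G)
    (k j : ℕ) (V E Q : Finset ℕ) (σ τ : ℕ → ℕ) (bd : ℕ → Fin 4 → ℕ × Bool) (cV : ℕ → ℤ × ℤ → ℕ) (cE : ℕ → ℤ × ℤ → Fin 2 → ℕ × Bool) : ℝ → ℝ → ℝ → Literature.MathematicalPhysics.QuantumFieldTheory.YMSpecies G →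
      Literature.MathematicalPhysics.QuantumFieldTheory.YMSpecies G → Prop :=
  open Literature.MathematicalPhysics.QuantumFieldTheory Literature.MathematicalPhysics.QuantumLattice MeasureTheory in
  let st := fun e : ℕ × Bool => if e.2 then σ e.1 else τ e.1; let en := fun e : ℕ × Bool => if e.2 then τ e.1 else σ e.1; let Γ := SimpleGraph.fromRel fun a b : ℕ => ∃ e ∈ E, σ e = a ∧ τ e = b; let dg := fun x : ℕ => (E.filter fun e => σ e = x ∨ τ e = x).card; let K := V.filter fun x => dg x = 5; let F := fun x : ℕ => x ∈ V ∧ ∀ c ∈ K, k / 4 < Γ.dist x c; let Dp := fun x : ℕ => x ∈ V ∧ ∀ c ∈ K, k / 2 < Γ.dist x c; let ib := fun a : ℤ × ℤ => |a.1| ≤ (k : ℤ) / 4 ∧ |a.2| ≤ (k : ℤ) / 4; let nx := fun (a : ℤ × ℤ) (μ : Fin 2) => if μ = 0 then (a.1 + 1, a.2) else (a.1, a.2 + 1); let Ed := (ℕ × ℕ) ⊕ (ℕ × ℕ); let PE : Finset Ed := (E ×ˢ V).disjSum (V ×ˢ E); let Cfg := ↥PE → G; let ν := Measure.pi fun _ :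 ↥PE => haarProbability G; let v := fun (U : Cfg) (e : Ed × Bool) => if h : e.1 ∈ PE then (if e.2 then U ⟨e.1, h⟩ else (U ⟨e.1, h⟩)⁻¹) else 1; let w := fun (U : Cfg) (e : Fin 4 → Ed × Bool) => (r.ρ (v U (e 0) * v U (e 1) * v U (e 2) * v U (e 3))).trace.re; let S := fun U : Cfg => (∑ q ∈ Q, ∑ y ∈ V, w U fun i => (Sum.inl ((bd q i).1, y), (bd q i).2)) + (∑ y ∈ V, ∑ q ∈ Q, w U fun i => (Sum.inr (y, (bd q i).1), (bd q i).2)) + ∑ e ∈ E, ∑ e' ∈ E, w U ![(Sum.inl (e, σ e'), true), (Sum.inr (τ e, e'), true), (Sum.inl (e, τ e'), false), (Sum.inr (σ e, e'), false)]; let d0 : Fin 4 → Fin 2 := ![0, 1, 0, 1]; let P := fun (x x' : ℕ) (U : Cfg) (p : Literature.MathematicalPhysics.QuantumLattice.ZdEdge 4) => let a := (p.1 0, p.1 1); let b := (p.1 2, p.1 3); if p.2 = 0 ∨ p.2 = 1 then v U (Sum.inl ((cE x a (d0 p.2)).1, cV x' b), (cE x a (d0 p.2)).2) else v U (Sum.inr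 (cV x a, (cE x' b (d0 p.2)).1), (cE x' b (d0 p.2)).2); fun (β m C : ℝ) (A B : YMSpecies G) => let X := fun f : Cfg → ℝ => (∫ U, f U * Real.exp (β * S U) ∂ν) / (∫ U, Real.exp (β * S U) ∂ν); ∀ x x' y y', F x → F x' → F y → F y' → |X (fun U => A.F (P x x' U) * B.F (P y y' U)) - X (fun U => A.F (P x x' U)) * X (fun U => B.F (P y y' U))| ≤ C * Real.exp (-(m * ((Γ.dist x y + Γ.dist x' y' : ℕ) : ℝ)))

/-- Support of a species inside the box of radius `R` — VERBATIM the route's `Sp`. -/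
def Sp {G : Type} [Group G] [MeasurableSpace G] : Literature.MathematicalPhysics.QuantumFieldTheory.YMSpecies G → ℕ → Prop :=
  open Literature.MathematicalPhysics.QuantumFieldTheory in
  fun (A : YMSpecies G) (R : ℕ) => ∀ p ∈ A.supp, ∀ i, |p.1 i| ≤ (R : ℤ)

/-- The **torus gap** for `(G, r)` — VERBATIM the body of the target `UniformLatticeGap` at `(G, r)`, which is
also VERBATIM the conclusion of the crux. -/
def TorusGap (G : Type) [Group G] [TopologicalSpace G] [IsTopologicalGroup G] [CompactSpace G]
    [MeasurableSpace G] [BorelSpace G] (r : Literature.MathematicalPhysics.QuantumFieldTheory.LatticeRep G) : Prop :=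
  open Literature.MathematicalPhysics.QuantumFieldTheory in
  ∃ β₀ : ℝ, ∀ β, β₀ ≤ β → ∃ m : ℝ, 0 < m ∧ ∃ S₁ : ℕ, ∀ A B : YMSpecies G, ∃ C : ℝ, ∀ S n, S₁ ≤ S → n ≤ S → |latticeConnectedCorr r.ρ β (2 * S + 1) A.F B.F n| ≤ C * Real.exp (-(m * n))

/-- Admissibility of the whole family at all curvature scales `k ≥ 8` and all `j`. -/
def AdmAll (V E Q : ℕ → ℕ → Finset ℕ) (σ τ : ℕ → ℕ → ℕ → ℕ) (bd : ℕ → ℕ → ℕ → Fin 4 → ℕ × Bool) (cV : ℕ → ℕ → ℕ → ℤ × ℤ → ℕ) (cE : ℕ → ℕ → ℕ → ℤ × ℤ → Fin 2 → ℕ × Bool) : Prop :=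
  ∀ k j, 8 ≤ k → Adm k j (V k j) (E k j) (Q k j) (σ k j) (τ k j) (bd k j) (cV k j) (cE k j)

/-- The **uniform-rate clustering hypothesis** of the crux — VERBATIM the conclusion of `CurvatureUniformity`:
one rate `m(β)` for all `k ≥ 8`, constants `C(β, k, A, B)` (note: `∃ C` comes AFTER `∀ k`, see §4). -/
def ClustHyp (G : Type) [Group G] [TopologicalSpace G] [IsTopologicalGroup G] [CompactSpace G]
    [MeasurableSpace G] [BorelSpace G] (r : Literature.MathematicalPhysics.QuantumFieldTheory.LatticeRep G)
    (V E Q : ℕ → ℕ → Finset ℕ) (σ τ : ℕ → ℕ → ℕ → ℕ) (bd : ℕ → ℕ → ℕ → Fin 4 → ℕ × Bool) (cV : ℕ → ℕ → ℕ → ℤ × ℤ → ℕ) (cE : ℕ → ℕ → ℕ → ℤ × ℤ → Fin 2 → ℕ × Bool) : Prop :=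
  open Literature.MathematicalPhysics.QuantumFieldTheory in
  ∃ β₁ : ℝ, ∀ β, β₁ ≤ β → ∃ m : ℝ, 0 < m ∧ ∀ k, 8 ≤ k → ∀ A B : YMSpecies G, Sp A (k / 8) → Sp B (k / 8) → ∃ C j₀, ∀ j, j₀ ≤ j → FamClust G r k j (V k j) (E k j) (Q k j) (σ k j) (τ k j) (bd k j) (cV k j) (cE k j) β m C A B

/-- **The crux, restated** through the named predicates. -/
def Crux : Prop :=
  open Literature.MathematicalPhysics.QuantumFieldTheory in
  ∀ (G : Type) [Group G] [TopologicalSpace G] [IsTopologicalGroup G] [CompactSpace G], IsCompactSimpleLieGroup G → letI : MeasurableSpace G := borel G; haveI : BorelSpace G := ⟨rfl⟩; ∀ r : LatticeRep G, ∀ (V E Q : ℕ → ℕ → Finset ℕ) (σ τ : ℕ → ℕ → ℕ → ℕ) (bd : ℕ → ℕ → ℕ → Fin 4 → ℕ × Bool) (cV : ℕ → ℕ → ℕ → ℤ × ℤ → ℕ) (cE : ℕ → ℕ → ℕ → ℤ × ℤ → Fin 2 → ℕ × Bool), AdmAll V E Q σ τ bd cV cE → ClustHyp G r V E Q σ τ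 bd cV cE → TorusGap G r

/-- `HyperbolicToTorus` IS `Crux`: the restatement only names sub-terms (checked by `Iff.rfl`). -/
theorem crux_iff : HyperbolicToTorus ↔ Crux := Iff.rfl

/-! ## §1 Decoupling: the conclusion ignores the family — disproof burden -/

/-- The conclusion for ALL `(G, r)`: the target `UniformLatticeGap` with the Borel σ-algebra fixed. -/
def TorusGapAll : Prop :=
  open Literature.MathematicalPhysics.QuantumFieldTheory in
  ∀ (G : Type) [Group G] [TopologicalSpace G] [IsTopologicalGroup G] [CompactSpace G], IsCompactSimpleLieGroup G → letI : MeasurableSpace G := borel G; haveI : BorelSpace G := ⟨rfl⟩; ∀ r : LatticeRep G, TorusGap G r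

/-- `TorusGapAll` is the target `UniformLatticeGap` (the target quantifies over all Borel structures, which
are all `borel G`). -/
theorem torusGapAll_iff_uniformLatticeGap : TorusGapAll ↔ UniformLatticeGap := by
  constructor
  · intro h G _ _ _ _ m hB hG r
    obtain ⟨hm⟩ := hB
    subst hm
    exact h G hG r
  · intro h G _ _ _ _ hG r
    letI : MeasurableSpace G := borel G
    haveI : BorelSpace G := ⟨rfl⟩
    exact h G hG r

/-- The target implies the crux: BOTH hypotheses are idle for truth. -/
theorem crux_of_torusGapAll (h : TorusGapAll) : Crux :=
  fun G _ _ _ _ hG r _ _ _ _ _ _ _ _ _ _ => h G hG r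

/-- **`UniformLatticeGap → HyperbolicToTorus`.** -/
theorem hyperbolicToTorus_of_uniformLatticeGap (h : UniformLatticeGap) : HyperbolicToTorus :=
  crux_iff.2 (crux_of_torusGapAll (torusGapAll_iff_uniformLatticeGap.2 h))

/-- **A refutation of the crux refutes the target**: `¬ HyperbolicToTorus → ¬ UniformLatticeGap`. -/
theorem not_uniformLatticeGap_of_not_hyperbolicToTorus (h : ¬ HyperbolicToTorus) : ¬ UniformLatticeGap :=
  fun hU => h (hyperbolicToTorus_of_uniformLatticeGap hU)

/-- **Disproof burden.** `¬ Crux` iff there are ONE compact simple `G`, a faithful `r` and a family that is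
admissible at all scales AND clusters at a `k`-uniform rate at all large `β` (a proof of `CurvatureAnchor ∧
CurvatureUniformity` for that family), while the torus gap FAILS for `(G, r)` (the weak-coupling lattice mass
gap negated). Neither half is available. -/
theorem not_crux_iff : ¬ Crux ↔ ∃ (G : Type) (_ : Group G) (_ : TopologicalSpace G) (_ : IsTopologicalGroup G)
    (_ : CompactSpace G), Literature.MathematicalPhysics.QuantumFieldTheory.IsCompactSimpleLieGroup G ∧
    letI : MeasurableSpace G := borel G; haveI : BorelSpace G := ⟨rfl⟩;
    ∃ (r : Literature.MathematicalPhysics.QuantumFieldTheory.LatticeRep G) (V E Q : ℕ → ℕ → Finset ℕ) (σ τ : ℕ → ℕ → ℕ → ℕ) (bd : ℕ → ℕ → ℕ → Fin 4 → ℕ × Bool) (cV : ℕ → ℕ → ℕ → ℤ × ℤ → ℕ) (cE : ℕ → ℕ → ℕ → ℤ × ℤ → Fin 2 → ℕ × Bool),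
      AdmAll V E Q σ τ bd cV cE ∧ ClustHyp G r V E Q σ τ bd cV cE ∧ ¬ TorusGap G r := by
  constructor
  · intro h
    by_contra hne
    apply h
    intro G _ _ _ _ hG r V E Q σ τ bd cV cE hA hC
    by_contra hT
    exact hne ⟨G, ‹_›, ‹_›, ‹_›, ‹_›, hG, r, V, E, Q, σ, τ, bd, cV, cE, hA, hC, hT⟩
  · rintro ⟨G, _, _, _, _, hG, r, V, E, Q, σ, τ, bd, cV, cE, hA, hC, hT⟩ h
    exact hT (h G hG r V E Q σ τ bd cV cE hA hC)

/-! ## §2 Load-bearing analysis: every weakening is still implied by the target -/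

/-- The crux with the CLUSTERING hypothesis dropped. -/
def CruxWithoutClust : Prop :=
  open Literature.MathematicalPhysics.QuantumFieldTheory in
  ∀ (G : Type) [Group G] [TopologicalSpace G] [IsTopologicalGroup G] [CompactSpace G], IsCompactSimpleLieGroup G → letI : MeasurableSpace G := borel G; haveI : BorelSpace G := ⟨rfl⟩; ∀ r : LatticeRep G, ∀ (V E Q : ℕ → ℕ → Finset ℕ) (σ τ : ℕ → ℕ → ℕ → ℕ) (bd : ℕ → ℕ → ℕ → Fin 4 → ℕ × Bool) (cV : ℕ → ℕ → ℕ → ℤ × ℤ → ℕ) (cE : ℕ → ℕ → ℕ → ℤ × ℤ → Fin 2 → ℕ × Bool), AdmAll V E Q σ τ bd cV cE → TorusGap G r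

/-- The crux with the ADMISSIBILITY hypothesis dropped. -/
def CruxWithoutAdm : Prop :=
  open Literature.MathematicalPhysics.QuantumFieldTheory in
  ∀ (G : Type) [Group G] [TopologicalSpace G] [IsTopologicalGroup G] [CompactSpace G], IsCompactSimpleLieGroup G → letI : MeasurableSpace G := borel G; haveI : BorelSpace G := ⟨rfl⟩; ∀ r : LatticeRep G, ∀ (V E Q : ℕ → ℕ → Finset ℕ) (σ τ : ℕ → ℕ → ℕ → ℕ) (bd : ℕ → ℕ → ℕ → Fin 4 → ℕ × Bool) (cV : ℕ → ℕ → ℕ → ℤ × ℤ → ℕ) (cE : ℕ → ℕ → ℕ → ℤ × ℤ → Fin 2 → ℕ × Bool), ClustHyp G r V E Q σ τ bd cV cE → TorusGap G r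

/-- Dropping clustering: still implied by the target. -/
theorem cruxWithoutClust_of_torusGapAll (h : TorusGapAll) : CruxWithoutClust :=
  fun G _ _ _ _ hG r _ _ _ _ _ _ _ _ _ => h G hG r

/-- Dropping admissibility: still implied by the target. -/
theorem cruxWithoutAdm_of_torusGapAll (h : TorusGapAll) : CruxWithoutAdm :=
  fun G _ _ _ _ hG r _ _ _ _ _ _ _ _ _ => h G hG r

/-- The weakenings imply the crux (trivially). -/
theorem crux_of_cruxWithoutClust (h : CruxWithoutClust) : Crux :=
  fun G _ _ _ _ hG r V E Q σ τ bd cV cE hA _ => h G hG r V E Q σ τ bd cV cE hA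

/-- The weakenings imply the crux (trivially). -/
theorem crux_of_cruxWithoutAdm (h : CruxWithoutAdm) : Crux :=
  fun G _ _ _ _ hG r V E Q σ τ bd cV cE _ hC => h G hG r V E Q σ τ bd cV cE hC

/-- **Dropping clustering leaves exactly "admissible families exist → lattice gap"** (admissibility is
`G`-free): so `¬ CruxWithoutClust ↔ (∃ admissible family) ∧ ¬ UniformLatticeGap` — no `_false_without_Clust`
lemma without refuting the target. The same holds for every hypothesis of this crux. -/
theorem cruxWithoutClust_iff :
    CruxWithoutClust ↔ ((∃ (V E Q : ℕ → ℕ → Finset ℕ) (σ τ : ℕ → ℕ → ℕ → ℕ) (bd : ℕ → ℕ → ℕ → Fin 4 → ℕ × Bool) (cV : ℕ → ℕ → ℕ → ℤ × ℤ → ℕ) (cE : ℕ → ℕ → ℕ → ℤ × ℤ → Fin 2 → ℕ × Bool), AdmAll V E Q σ τ bd cV cE) → TorusGapAll) := by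
  constructor
  · rintro h ⟨V, E, Q, σ, τ, bd, cV, cE, hA⟩ G _ _ _ _ hG r
    exact h G hG r V E Q σ τ bd cV cE hA
  · intro h G _ _ _ _ hG r V E Q σ τ bd cV cE hA
    exact h ⟨V, E, Q, σ, τ, bd, cV, cE, hA⟩ G hG r

/-! ## §3 Vacuity threat: chart rigidity excludes the intended witness family -/

/-- **If no family is admissible at all scales, the crux is (vacuously) TRUE** — and `CurvatureAnchor` false. -/
theorem crux_of_no_admissible (h : ¬ ∃ (V E Q : ℕ → ℕ → Finset ℕ) (σ τ : ℕ → ℕ → ℕ → ℕ) (bd : ℕ → ℕ → ℕ → Fin 4 → ℕ × Bool) (cV : ℕ → ℕ → ℕ → ℤ × ℤ → ℕ) (cE : ℕ → ℕ → ℕ → ℤ × ℤ → Fin 2 → ℕ × Bool), AdmAll V E Q σ τ bd cV cE) : Crux :=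
  fun _ _ _ _ _ _ _ V E Q σ τ bd cV cE hA _ => absurd ⟨V, E, Q, σ, τ, bd, cV, cE, hA⟩ h

/-- **Chart rigidity applied to `Adm`** (landed core:
`Theorems.HyperbolicToTorus.Negative.adm_chart_interior_degree_four`): under `Adm k j …`, at every flat point
`x` every vertex charted at an interior box position has degree `4` — no cone strictly inside a chart, although
`F` only excludes cones from the graph ball of radius `k/4`, not from the `ℓ^∞` box (graph reach `2(k/4)`).
The intended `{4,5}_k` witness violates this for `k ≥ 12` (module docstring of the landed file). -/
theorem adm_flat_chart_interior_degree_four {k j : ℕ} {V E Q : Finset ℕ} {σ τ : ℕ → ℕ}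
    {bd : ℕ → Fin 4 → ℕ × Bool} {cV : ℕ → ℤ × ℤ → ℕ} {cE : ℕ → ℤ × ℤ → Fin 2 → ℕ × Bool}
    (h : Adm k j V E Q σ τ bd cV cE) :
    let Γ := SimpleGraph.fromRel fun a b : ℕ => ∃ e ∈ E, σ e = a ∧ τ e = b
    let dg := fun x : ℕ => (E.filter fun e => σ e = x ∨ τ e = x).card
    let K := V.filter fun x => dg x = 5
    ∀ x, (x ∈ V ∧ ∀ c ∈ K, k / 4 < Γ.dist x c) →
      ∀ a : ℤ × ℤ, |a.1| ≤ (k : ℤ) / 4 - 1 → |a.2| ≤ (k : ℤ) / 4 - 1 → dg (cV x a) = 4 := by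
  intro Γ dg K x hx a h1 h2
  obtain ⟨-, h2', h3', h4', -, -, -, -, h9'⟩ := h
  exact Summit.QuantumFields.YangMills.Theorems.HyperbolicToTorus.Negative.adm_chart_interior_degree_four
    k V E Q σ τ bd cV cE h2' h3' h4' x (h9' x hx) a h1 h2

/-- Hence no cone (`dg = 5`) is charted strictly inside the chart of a flat point. -/
theorem adm_flat_chart_interior_not_cone {k j : ℕ} {V E Q : Finset ℕ} {σ τ : ℕ → ℕ}
    {bd : ℕ → Fin 4 → ℕ × Bool} {cV : ℕ → ℤ × ℤ → ℕ} {cE : ℕ → ℤ × ℤ → Fin 2 → ℕ × Bool}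
    (h : Adm k j V E Q σ τ bd cV cE) :
    let Γ := SimpleGraph.fromRel fun a b : ℕ => ∃ e ∈ E, σ e = a ∧ τ e = b
    let dg := fun x : ℕ => (E.filter fun e => σ e = x ∨ τ e = x).card
    let K := V.filter fun x => dg x = 5
    ∀ x, (x ∈ V ∧ ∀ c ∈ K, k / 4 < Γ.dist x c) →
      ∀ a : ℤ × ℤ, |a.1| ≤ (k : ℤ) / 4 - 1 → |a.2| ≤ (k : ℤ) / 4 - 1 → cV x a ∉ K := by
  intro Γ dg K x hx a h1 h2 hK
  have h4 := adm_flat_chart_interior_degree_four h x hx a h1 h2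
  have h5 : dg (cV x a) = 5 := (Finset.mem_filter.1 hK).2
  simp only [dg] at h4 h5
  omega

/-! ## §4 The clustering hypothesis carries no information below the curvature scale -/

/-- **Far clustering + a trivial bound ⇒ clustering at all separations** (abstract): if `Φ ≤ B₀` everywhere and
`Φ i ≤ C e^{-m dᵢ}` whenever `dᵢ ≥ k`, then `Φ i ≤ max C (B₀ e^{m k}) · e^{-m dᵢ}` for all `i`. [folklore] -/
theorem le_of_far {ι : Type*} (Φ : ι → ℝ) (d : ι → ℕ) {B₀ C m : ℝ} (k : ℕ) (hm : 0 ≤ m) (hB₀ : 0 ≤ B₀)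
    (hB : ∀ i, Φ i ≤ B₀) (hfar : ∀ i, k ≤ d i → Φ i ≤ C * Real.exp (-(m * d i))) (i : ι) :
    Φ i ≤ max C (B₀ * Real.exp (m * k)) * Real.exp (-(m * d i)) := by
  by_cases hk : k ≤ d i
  · exact (hfar i hk).trans (mul_le_mul_of_nonneg_right (le_max_left _ _) (Real.exp_nonneg _))
  · have hk : d i < k := Nat.lt_of_not_le hk
    have hdk : (d i : ℝ) ≤ k := by exact_mod_cast hk.le
    have h1 : (1 : ℝ) ≤ Real.exp (m * k) * Real.exp (-(m * d i)) := by
      rw [← Real.exp_add]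
      exact Real.one_le_exp (by nlinarith)
    calc Φ i ≤ B₀ * 1 := by rw [mul_one]; exact hB i
      _ ≤ B₀ * (Real.exp (m * k) * Real.exp (-(m * d i))) := mul_le_mul_of_nonneg_left h1 hB₀
      _ = B₀ * Real.exp (m * k) * Real.exp (-(m * d i)) := by ring
      _ ≤ max C (B₀ * Real.exp (m * k)) * Real.exp (-(m * d i)) :=
        mul_le_mul_of_nonneg_right (le_max_right _ _) (Real.exp_nonneg _)

set_option linter.unusedVariables false in
/-- `FamClust` restricted to separations `dist x y + dist x' y' ≥ k` ("trans-curvature" pairs only) — VERBATIM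
the route's clustering predicate with ONE extra hypothesis `k ≤ Γ.dist x y + Γ.dist x' y'`. -/
def FamClustFar (G : Type) [Group G] [TopologicalSpace G] [IsTopologicalGroup G] [CompactSpace G]
    [MeasurableSpace G] [BorelSpace G] (r : Literature.MathematicalPhysics.QuantumFieldTheory.LatticeRep G)
    (k j : ℕ) (V E Q : Finset ℕ) (σ τ : ℕ → ℕ) (bd : ℕ → Fin 4 → ℕ × Bool) (cV : ℕ → ℤ × ℤ → ℕ) (cE : ℕ → ℤ × ℤ → Fin 2 → ℕ × Bool) : ℝ → ℝ → ℝ → Literature.MathematicalPhysics.QuantumFieldTheory.YMSpecies G →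
      Literature.MathematicalPhysics.QuantumFieldTheory.YMSpecies G → Prop :=
  open Literature.MathematicalPhysics.QuantumFieldTheory Literature.MathematicalPhysics.QuantumLattice MeasureTheory in
  let st := fun e : ℕ × Bool => if e.2 then σ e.1 else τ e.1; let en := fun e : ℕ × Bool => if e.2 then τ e.1 else σ e.1; let Γ := SimpleGraph.fromRel fun a b : ℕ => ∃ e ∈ E, σ e = a ∧ τ e = b; let dg := fun x : ℕ => (E.filter fun e => σ e = x ∨ τ e = x).card; let K := V.filter fun x => dg x = 5; let F := fun x : ℕ => x ∈ V ∧ ∀ c ∈ K, k / 4 < Γ.dist x c; let Dp := fun x : ℕ => x ∈ V ∧ ∀ c ∈ K, k / 2 < Γ.dist x c; let ib := fun a : ℤ × ℤ => |a.1| ≤ (k : ℤ) / 4 ∧ |a.2| ≤ (k : ℤ) / 4; let nx := fun (a : ℤ × ℤ) (μ : Fin 2) => if μ = 0 then (a.1 + 1, a.2) else (a.1, a.2 + 1); let Ed := (ℕ × ℕ) ⊕ (ℕ × ℕ); let PE : Finset Ed := (E ×ˢ V).disjSum (V ×ˢ E); let Cfg := ↥PE → G; let ν := Measure.pi fun _ :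 ↥PE => haarProbability G; let v := fun (U : Cfg) (e : Ed × Bool) => if h : e.1 ∈ PE then (if e.2 then U ⟨e.1, h⟩ else (U ⟨e.1, h⟩)⁻¹) else 1; let w := fun (U : Cfg) (e : Fin 4 → Ed × Bool) => (r.ρ (v U (e 0) * v U (e 1) * v U (e 2) * v U (e 3))).trace.re; let S := fun U : Cfg => (∑ q ∈ Q, ∑ y ∈ V, w U fun i => (Sum.inl ((bd q i).1, y), (bd q i).2)) + (∑ y ∈ V, ∑ q ∈ Q, w U fun i => (Sum.inr (y, (bd q i).1), (bd q i).2)) + ∑ e ∈ E, ∑ e' ∈ E, w U ![(Sum.inl (e, σ e'), true), (Sum.inr (τ e, e'), true), (Sum.inl (e, τ e'), false), (Sum.inr (σ e, e'), false)]; let d0 : Fin 4 → Fin 2 := ![0, 1, 0, 1]; let P := fun (x x' : ℕ) (U : Cfg) (p : Literature.MathematicalPhysics.QuantumLattice.ZdEdge 4) => let a := (p.1 0, p.1 1); let b := (p.1 2, p.1 3); if p.2 = 0 ∨ p.2 = 1 then v U (Sum.inl ((cE x a (d0 p.2)).1, cV x' b), (cE x a (d0 p.2)).2) else v U (Sum.inr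 (cV x a, (cE x' b (d0 p.2)).1), (cE x' b (d0 p.2)).2); fun (β m C : ℝ) (A B : YMSpecies G) => let X := fun f : Cfg → ℝ => (∫ U, f U * Real.exp (β * S U) ∂ν) / (∫ U, Real.exp (β * S U) ∂ν); ∀ x x' y y', F x → F x' → F y → F y' → k ≤ Γ.dist x y + Γ.dist x' y' → |X (fun U => A.F (P x x' U) * B.F (P y y' U)) - X (fun U => A.F (P x x' U)) * X (fun U => B.F (P y y' U))| ≤ C * Real.exp (-(m * ((Γ.dist x y + Γ.dist x' y' : ℕ) : ℝ)))

set_option linter.unusedVariables false in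
/-- Uniform boundedness of the chart-read connected expectations by the constant `C` (holds with
`C = 2 ‖A‖_∞ ‖B‖_∞` because `X` is a normalised positive expectation and species are bounded) — VERBATIM the
route's clustering predicate with the exponential factor deleted (`β, m` kept for alignment, `m` unused). -/
def FamCorrBdd (G : Type) [Group G] [TopologicalSpace G] [IsTopologicalGroup G] [CompactSpace G]
    [MeasurableSpace G] [BorelSpace G] (r : Literature.MathematicalPhysics.QuantumFieldTheory.LatticeRep G)
    (k j : ℕ) (V E Q : Finset ℕ) (σ τ : ℕ → ℕ) (bd : ℕ → Fin 4 → ℕ × Bool) (cV : ℕ → ℤ × ℤ → ℕ) (cE : ℕ → ℤ × ℤ → Fin 2 → ℕ × Bool) : ℝ → ℝ → ℝ → Literature.MathematicalPhysics.QuantumFieldTheory.YMSpecies G →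
      Literature.MathematicalPhysics.QuantumFieldTheory.YMSpecies G → Prop :=
  open Literature.MathematicalPhysics.QuantumFieldTheory Literature.MathematicalPhysics.QuantumLattice MeasureTheory in
  let st := fun e : ℕ × Bool => if e.2 then σ e.1 else τ e.1; let en := fun e : ℕ × Bool => if e.2 then τ e.1 else σ e.1; let Γ := SimpleGraph.fromRel fun a b : ℕ => ∃ e ∈ E, σ e = a ∧ τ e = b; let dg := fun x : ℕ => (E.filter fun e => σ e = x ∨ τ e = x).card; let K := V.filter fun x => dg x = 5; let F := fun x : ℕ => x ∈ V ∧ ∀ c ∈ K, k / 4 < Γ.dist x c; let Dp := fun x : ℕ => x ∈ V ∧ ∀ c ∈ K, k / 2 < Γ.dist x c; let ib := fun a : ℤ × ℤ => |a.1| ≤ (k : ℤ) / 4 ∧ |a.2| ≤ (k : ℤ) / 4; let nx := fun (a : ℤ × ℤ) (μ : Fin 2) => if μ = 0 then (a.1 + 1, a.2) else (a.1, a.2 + 1); let Ed := (ℕ × ℕ) ⊕ (ℕ × ℕ); let PE : Finset Ed := (E ×ˢ V).disjSum (V ×ˢ E); let Cfg := ↥PE → G; let ν := Measure.pi fun _ :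 ↥PE => haarProbability G; let v := fun (U : Cfg) (e : Ed × Bool) => if h : e.1 ∈ PE then (if e.2 then U ⟨e.1, h⟩ else (U ⟨e.1, h⟩)⁻¹) else 1; let w := fun (U : Cfg) (e : Fin 4 → Ed × Bool) => (r.ρ (v U (e 0) * v U (e 1) * v U (e 2) * v U (e 3))).trace.re; let S := fun U : Cfg => (∑ q ∈ Q, ∑ y ∈ V, w U fun i => (Sum.inl ((bd q i).1, y), (bd q i).2)) + (∑ y ∈ V, ∑ q ∈ Q, w U fun i => (Sum.inr (y, (bd q i).1), (bd q i).2)) + ∑ e ∈ E, ∑ e' ∈ E, w U ![(Sum.inl (e, σ e'), true), (Sum.inr (τ e, e'), true), (Sum.inl (e, τ e'), false), (Sum.inr (σ e, e'), false)]; let d0 : Fin 4 → Fin 2 := ![0, 1, 0, 1]; let P := fun (x x' : ℕ) (U : Cfg) (p : Literature.MathematicalPhysics.QuantumLattice.ZdEdge 4) => let a := (p.1 0, p.1 1); let b := (p.1 2, p.1 3); if p.2 = 0 ∨ p.2 = 1 then v U (Sum.inl ((cE x a (d0 p.2)).1, cV x' b), (cE x a (d0 p.2)).2) else v U (Sum.inr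 (cV x a, (cE x' b (d0 p.2)).1), (cE x' b (d0 p.2)).2); fun (β m C : ℝ) (A B : YMSpecies G) => let X := fun f : Cfg → ℝ => (∫ U, f U * Real.exp (β * S U) ∂ν) / (∫ U, Real.exp (β * S U) ∂ν); ∀ x x' y y', F x → F x' → F y → F y' → |X (fun U => A.F (P x x' U) * B.F (P y y' U)) - X (fun U => A.F (P x x' U)) * X (fun U => B.F (P y y' U))| ≤ C

/-- **Clustering at scale `k` follows from trans-curvature clustering plus boundedness**, with the constant
`max C (B₀ e^{m k})`: the hypothesis `FamClust … β m C A B` of the crux constrains NOTHING at separations `< k`,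
in particular nothing inside a single flat chart (diameter `k/2`). -/
theorem famClust_of_far (G : Type) [Group G] [TopologicalSpace G] [IsTopologicalGroup G] [CompactSpace G]
    [MeasurableSpace G] [BorelSpace G] (r : Literature.MathematicalPhysics.QuantumFieldTheory.LatticeRep G)
    (k j : ℕ) (V E Q : Finset ℕ) (σ τ : ℕ → ℕ) (bd : ℕ → Fin 4 → ℕ × Bool) (cV : ℕ → ℤ × ℤ → ℕ) (cE : ℕ → ℤ × ℤ → Fin 2 → ℕ × Bool)
    {β m C B₀ : ℝ} {A B : Literature.MathematicalPhysics.QuantumFieldTheory.YMSpecies G} (hm : 0 ≤ m) (hB₀ : 0 ≤ B₀)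
    (hB : FamCorrBdd G r k j V E Q σ τ bd cV cE β m B₀ A B)
    (hfar : FamClustFar G r k j V E Q σ τ bd cV cE β m C A B) :
    FamClust G r k j V E Q σ τ bd cV cE β m (max C (B₀ * Real.exp (m * k))) A B := by
  intro x x' y y' hx hx' hy hy'
  exact le_of_far (ι := Unit) (fun _ => _) (fun _ => _) k hm hB₀ (fun _ => hB x x' y y' hx hx' hy hy')
    (fun _ hk => hfar x x' y y' hx hx' hy hy' hk) ()

/-- The clustering hypothesis with `FamClust` replaced by its trans-curvature restriction `FamClustFar`. -/
def ClustHypFar (G : Type) [Group G] [TopologicalSpace G] [IsTopologicalGroup G] [CompactSpace G]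
    [MeasurableSpace G] [BorelSpace G] (r : Literature.MathematicalPhysics.QuantumFieldTheory.LatticeRep G)
    (V E Q : ℕ → ℕ → Finset ℕ) (σ τ : ℕ → ℕ → ℕ → ℕ) (bd : ℕ → ℕ → ℕ → Fin 4 → ℕ × Bool) (cV : ℕ → ℕ → ℕ → ℤ × ℤ → ℕ) (cE : ℕ → ℕ → ℕ → ℤ × ℤ → Fin 2 → ℕ × Bool) : Prop :=
  open Literature.MathematicalPhysics.QuantumFieldTheory in
  ∃ β₁ : ℝ, ∀ β, β₁ ≤ β → ∃ m : ℝ, 0 < m ∧ ∀ k, 8 ≤ k → ∀ A B : YMSpecies G, Sp A (k / 8) → Sp B (k / 8) → ∃ C j₀, ∀ j, j₀ ≤ j → FamClustFar G r k j (V k j) (E k j) (Q k j) (σ k j) (τ k j) (bd k j) (cV k j) (cE k j) β m C A B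

/-- **`ClustHyp` follows from its trans-curvature restriction** once the chart-read connected expectations are
bounded uniformly in `j` (constant `B₀(β, k, A, B)`): the `k`-dependent constant `C(β,k,A,B)` of the route
absorbs everything below separation `k`. So, as typed, the crux's hypothesis is "infrared clustering across the
hyperbolic structure" and carries no flat-chart information for the intended local-limit proof (REPAIR R2:
`∃ C` before `∀ k`). -/
theorem clustHyp_of_far (G : Type) [Group G] [TopologicalSpace G] [IsTopologicalGroup G] [CompactSpace G]
    [MeasurableSpace G] [BorelSpace G] (r : Literature.MathematicalPhysics.QuantumFieldTheory.LatticeRep G)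
    (V E Q : ℕ → ℕ → Finset ℕ) (σ τ : ℕ → ℕ → ℕ → ℕ) (bd : ℕ → ℕ → ℕ → Fin 4 → ℕ × Bool) (cV : ℕ → ℕ → ℕ → ℤ × ℤ → ℕ) (cE : ℕ → ℕ → ℕ → ℤ × ℤ → Fin 2 → ℕ × Bool)
    (hbdd : ∀ β : ℝ, ∀ k, 8 ≤ k → ∀ A B : Literature.MathematicalPhysics.QuantumFieldTheory.YMSpecies G, ∃ B₀ : ℝ, 0 ≤ B₀ ∧ ∃ j₀ : ℕ, ∀ j, j₀ ≤ j →
      FamCorrBdd G r k j (V k j) (E k j) (Q k j) (σ k j) (τ k j) (bd k j) (cV k j) (cE k j) β 0 B₀ A B)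
    (h : ClustHypFar G r V E Q σ τ bd cV cE) : ClustHyp G r V E Q σ τ bd cV cE := by
  obtain ⟨β₁, h⟩ := h
  refine ⟨β₁, fun β hβ => ?_⟩
  obtain ⟨m, hm, h⟩ := h β hβ
  refine ⟨m, hm, fun k hk A B hA hB => ?_⟩
  obtain ⟨C, j₀, hC⟩ := h k hk A B hA hB
  obtain ⟨B₀, hB₀, j₁, hb⟩ := hbdd β k hk A B
  refine ⟨max C (B₀ * Real.exp (m * k)), max j₀ j₁, fun j hj => ?_⟩
  have hbj : FamCorrBdd G r k j (V k j) (E k j) (Q k j) (σ k j) (τ k j) (bd k j) (cV k j) (cE k j) β m B₀ A B :=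
    hb j ((le_max_right _ _).trans hj)
  exact famClust_of_far G r k j _ _ _ _ _ _ _ _ hm.le hB₀ hbj (hC j ((le_max_left _ _).trans hj))

/-! ## §5 Tightness of the conclusion as a `(G, r, β)`-statement (tree: `PoincareToGap.Negative`) -/

/-- **`n ≤ S` cannot be dropped from `TorusGap`**: for every compact simple `G`, faithful `r` and real `β` the
all-separations clustering of all torus time-correlations is FALSE (periodicity `corr(2S+1) = corr(0) =
Cov` and a volume-uniform plaquette variance lower bound; `PoincareToGap.Negative.Tightness` /
`.PlaquetteVariance`). By §1 this does NOT refute the crux with strengthened conclusion (no hypothesis witness). -/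
theorem torusGap_allSep_false (G : Type) [Group G] [TopologicalSpace G] [IsTopologicalGroup G] [CompactSpace G]
    [MeasurableSpace G] [BorelSpace G] (hG : Literature.MathematicalPhysics.QuantumFieldTheory.IsCompactSimpleLieGroup G)
    (r : Literature.MathematicalPhysics.QuantumFieldTheory.LatticeRep G) (β : ℝ) :
    ¬ (∃ m : ℝ, 0 < m ∧ ∃ S₁ : ℕ, ∀ A B : Literature.MathematicalPhysics.QuantumFieldTheory.YMSpecies G, ∃ C : ℝ, ∀ S n : ℕ, S₁ ≤ S →
      |Literature.MathematicalPhysics.QuantumFieldTheory.latticeConnectedCorr r.ρ β (2 * S + 1) A.F B.F n| ≤ C * Real.exp (-(m * n))) := by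
  obtain ⟨g₀, hg₀⟩ : ∃ a : G, a ≠ 1 := by
    obtain ⟨-, ⟨a, b, hab⟩, -⟩ := hG.1
    exact ⟨a, fun ha => hab (by rw [ha, one_mul, mul_one])⟩
  obtain ⟨A, v, hv, hA⟩ := Theorems.PoincareToGap.Negative.exists_cov_lower_bound r hg₀ β
  exact Theorems.PoincareToGap.Negative.not_clusteringAllSep_of_cov_lower_bound r β A A hv
    fun S₁ => ⟨max S₁ 1, le_max_left _ _, hA _ (le_max_right _ _)⟩

end Summit.QuantumFields.YangMills.Cruxes.HyperbolicToTorus.Disproof
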